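import Mathlib.Analysis.SpecialFunctions.Trigonometric.Deriv
import Mathlib.Analysis.SpecialFunctions.Sqrt
import Literature.MathematicalPhysics.QuantumLattice.SpectroscopicGapRatio
import HarnessLib

/-!
# The universal nodal heat-transport dictionary of a d-wave superconductor (REFVALS-2 §138)

The residual (`T → 0`) electronic thermal conductivity of a clean `d_{x²−y²}` superconductor is
«universal»: [DurstLee2000UniversalThermalConductivity; GrafYipSaulsRainer1996ThermalConductivity],
as used by [SutherlandEtAl2003CuprateThermalConductivityGap, Eq. 2] and
[HawthornEtAl2007Tl2201GapHeatTransport, Eq. 3],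

  `κ₀/T = (k_B²/3ħ) · (n/d) · (v_F/v₂ + v₂/v_F)`,

where `n` is the number of CuO₂ planes per unit cell, `d` the c-axis lattice constant, and `v_F`, `v₂`
(also written `v_Δ`) the quasiparticle velocities normal and tangential to the Fermi surface at the
node — «the only two parameters that enter the low-energy spectrum `E = ħ√(v_F²k₁² + v₂²k₂²)`»
[SutherlandEtAl2003CuprateThermalConductivityGap, p. 5]; `v₂ = (1/ħk_F) dΔ/dφ|_node` (their Eq. 3),
so that for `Δ(φ) = Δ₀ cos 2φ` one has `Δ₀ = ħ k_F v₂/2` (their Fig. 6 caption) and, when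
`v_F ≫ v₂`, `κ₀/T ≃ (k_B²/6)(n/c) k_F v_F/Δ₀` [HawthornEtAl2007Tl2201GapHeatTransport, Eq. 5].

This file records the EXACT algebra of that dictionary and the arithmetic behind REFVALS-2 §138
(cell hubbard-downfold, seat lit-2); it introduces no physics beyond the printed formulae:

* §1 the anisotropy sum `A(r) = r + 1/r` of the ratio `r = v_F/v₂`: symmetric under `r ↦ 1/r`,
  `A(r) − 2 = (r − 1)²/r`, hence `A ≥ 2` with equality iff `r = 1` (the printed «minimum possible
  value … when v_F/v₂ = 1»), strictly increasing on `r ≥ 1`, with the explicit inverse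
  `r = (y + √(y² − 4))/2` and the large-`r` form `A(r) = r(1 + 1/r²)` (the relative size of the term
  [HawthornEtAl2007Tl2201GapHeatTransport, Eq. 5] drops);
* §2 `κ(P, r) = P · A(r)`: minimum `2P`, monotone, invertible for `κ ≥ 2P`, bracket
  `P r ≤ κ ≤ P r (1 + 1/r²)`;
* §3 the d-wave node: `Δ₀ cos 2φ` vanishes at `φ = π/4` with slope `−2Δ₀` (`HasDerivAt`), so
  `|dΔ/dφ|_node = 2Δ₀`, `v₂ = 2Δ₀/(ħk_F)`, `Δ₀ = ħk_F v₂/2`, and Hawthorn's Eq. 5 IS the leading term of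
  Eq. 3 (`ħ` cancels: `(k_B²/3ħ)(n/c)·v_F/v₂ = (k_B²/6)(n/c) k_F v_F/Δ₀`);
* §4 the SI constant `k_B²/3ħ = 2πk_B²/(3h) ∈ (6.025166, 6.025169) × 10⁻¹³ W K⁻²` from the exact
  2019-SI `k_B`, `h` (reusing `boltzmannSI`, `planckSI`, `hbarSI`) and Mathlib's `π` bounds, and the
  family prefactors `P = (k_B²/3ħ)(n/d)` in `μW K⁻² cm⁻¹`: YBa₂Cu₃O_y `(2, 11.7 Å) ↦ 10.2994…`,
  La₂₋ₓSrₓCuO₄ `(2, 13.2 Å) ↦ 9.1290…` (twice it `= 18.258…`, the printed «18.3» minimum),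
  Bi-2212 `(4, 30.9 Å) ↦ 7.7995…`, Tl-2201 `(2, 23.2 Å) ↦ 5.1941…`;
* §5 CONSISTENCY ROWS of [SutherlandEtAl2003CuprateThermalConductivityGap, Table I]: every printed
  pair `(κ₀/T ± err, v_F/v₂)` satisfies `P · A(r) ∈ [κ₀/T − err, κ₀/T + err]` — YBCO `(85 ± 10, 7.9)`,
  `(91 ± 13, 8.7)`, `(120 ± 12, 11.5)`, `(160 ± 12, 15.5)`; LSCO `(22 ± 2, 1.9)`, `(26 ± 10, 2.4)`,
  `(96 ± 7, 10.4)`, `(330 ± 40, 36)`; Bi-2212 `(150 ± 30, 19)`; Tl-2201 `(1400 ± 70, 270)`;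
* §6 the energy scale `ħk_F v_F/2 ∈ (575.93, 575.94) meV` at the printed `k_F = 0.7 Å⁻¹`,
  `v_F = 2.5 × 10⁷ cm/s`, whence the printed `Δ₀ = 71(73) / 66 / 50 / 37 / 30 meV` column as
  `ħk_F v_F/(2r)`, the ARPES value `ħk_F v₂/2 ∈ (28.79, 28.80) meV` for `v₂ = 1.25 × 10⁶ cm/s`
  [MesotEtAl1999Bi2212GapSlopeARPES], and the [HawthornEtAl2007Tl2201GapHeatTransport, Table I]
  column `Δ₀ = 40 / 22 / 23 / 28 / 9.5 / 6.7 meV` (and `2.3 meV` at the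
  [ProustEtAl2002Tl2201OverdopedHeatTransport] value `1.4 mW K⁻² cm⁻¹`) from Eq. 5 with the printed
  `v_F = 2.7 × 10⁷ cm/s`, `k_F = 0.7 Å⁻¹`, `n = 2`, `c = 23.2 Å`, together with `Δ₀/k_BT_c`.

Pure algebra and rational/`π`-bracket arithmetic on printed numbers; which samples are in the clean
limit (YBCO, Tl-2201, Bi-2212 yes; underdoped LSCO no) is the papers' statement, not this file's.
AI-produced formalisation (H21, cell hubbard-downfold, seat lit-2, 2026-08-29); no facts, no axioms
beyond Mathlib's, no `sorry`.
-/

noncomputable section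

open Real

namespace Literature.MathematicalPhysics.QuantumLattice.NodalHeatTransport

/-! ## §1 The anisotropy sum `A(r) = r + 1/r` -/

/-- The anisotropy sum `A(r) = r + 1/r` of the velocity ratio `r = v_F/v₂` — the bracket of Sutherland et al.'s Eq. 2.
[cite: SutherlandEtAl2003CuprateThermalConductivityGap, Eq. 2] -/
def anisotropySum (r : ℝ) : ℝ := r + r⁻¹

/-- Unfolding. [cite: SutherlandEtAl2003CuprateThermalConductivityGap, Eq. 2] -/
theorem anisotropySum_def (r : ℝ) : anisotropySum r = r + r⁻¹ := rfl

/-- `A` is symmetric under `v_F ↔ v₂`. [cite: SutherlandEtAl2003CuprateThermalConductivityGap, Eq. 2] -/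
theorem anisotropySum_inv (r : ℝ) : anisotropySum r⁻¹ = anisotropySum r := by
  simp [anisotropySum, add_comm]

/-- `A(1) = 2`. [cite: SutherlandEtAl2003CuprateThermalConductivityGap, Fig. 5 caption] -/
theorem anisotropySum_one : anisotropySum 1 = 2 := by norm_num [anisotropySum]

/-- `A(r) − 2 = (r − 1)²/r`. [cite: SutherlandEtAl2003CuprateThermalConductivityGap, Eq. 2] -/
theorem anisotropySum_sub_two {r : ℝ} (hr : r ≠ 0) : anisotropySum r - 2 = (r - 1) ^ 2 / r := by
  unfold anisotropySum
  field_simp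
  ring

/-- The printed «minimum possible value allowed by Eq. 2, namely when `v_F/v₂ = 1`»: `A(r) ≥ 2`
for `r > 0`. [cite: SutherlandEtAl2003CuprateThermalConductivityGap, Fig. 5 caption] -/
theorem two_le_anisotropySum {r : ℝ} (hr : 0 < r) : 2 ≤ anisotropySum r := by
  have h := anisotropySum_sub_two hr.ne'
  have : 0 ≤ (r - 1) ^ 2 / r := by positivity
  linarith

/-- … with equality iff `r = 1`. [cite: SutherlandEtAl2003CuprateThermalConductivityGap, Fig. 5 caption] -/
theorem anisotropySum_eq_two_iff {r : ℝ} (hr : 0 < r) : anisotropySum r = 2 ↔ r = 1 := by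
  constructor
  · intro h
    have h2 := anisotropySum_sub_two hr.ne'
    rw [h, sub_self] at h2
    have h3 : (r - 1) ^ 2 = 0 := by
      have := div_eq_zero_iff.mp h2.symm
      rcases this with h4 | h4
      · exact h4
      · exact absurd h4 hr.ne'
    have : r - 1 = 0 := pow_eq_zero_iff (n := 2) (by norm_num) |>.mp h3
    linarith
  · rintro rfl
    exact anisotropySum_one

/-- The finite-difference identity `A(b) − A(a) = (b − a)(ab − 1)/(ab)`.
[cite: SutherlandEtAl2003CuprateThermalConductivityGap, Eq. 2] -/
theorem anisotropySum_sub {a b : ℝ} (ha : a ≠ 0) (hb : b ≠ 0) :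
    anisotropySum b - anisotropySum a = (b - a) * (a * b - 1) / (a * b) := by
  unfold anisotropySum
  field_simp
  ring

/-- `A` is strictly increasing on `r ≥ 1` (so `κ₀/T` determines `v_F/v₂ ≥ 1` uniquely).
[cite: SutherlandEtAl2003CuprateThermalConductivityGap, Eq. 2] -/
theorem anisotropySum_lt {a b : ℝ} (ha : 1 ≤ a) (hab : a < b) : anisotropySum a < anisotropySum b := by
  have ha0 : 0 < a := by linarith
  have hb0 : 0 < b := by linarith
  have hab1 : 1 < a * b := by nlinarith
  have h := anisotropySum_sub ha0.ne' hb0.ne'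
  have : 0 < (b - a) * (a * b - 1) / (a * b) := by
    apply div_pos _ (mul_pos ha0 hb0)
    exact mul_pos (by linarith) (by linarith)
  linarith

/-- `A` is strictly monotone on `[1, ∞)`. [cite: SutherlandEtAl2003CuprateThermalConductivityGap, Eq. 2] -/
theorem anisotropySum_strictMonoOn : StrictMonoOn anisotropySum (Set.Ici 1) := by
  intro a ha b _ hab
  exact anisotropySum_lt ha hab

/-- `A` is injective on `[1, ∞)`. [cite: SutherlandEtAl2003CuprateThermalConductivityGap, Eq. 2] -/
theorem anisotropySum_injOn : Set.InjOn anisotropySum (Set.Ici 1) :=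
  anisotropySum_strictMonoOn.injOn

/-- The large-ratio form `A(r) = r · (1 + 1/r²)`: dropping `v₂/v_F` changes `κ₀/T` by the RELATIVE
amount `1/r²` (behind Hawthorn's «for `v_F ≫ v_Δ`»).
[cite: HawthornEtAl2007Tl2201GapHeatTransport, Eq. 5] -/
theorem anisotropySum_eq_mul {r : ℝ} (hr : r ≠ 0) : anisotropySum r = r * (1 + (r ^ 2)⁻¹) := by
  unfold anisotropySum
  field_simp

/-- `r ≤ A(r)` for `r > 0`. [cite: HawthornEtAl2007Tl2201GapHeatTransport, Eq. 5] -/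
theorem le_anisotropySum {r : ℝ} (hr : 0 < r) : r ≤ anisotropySum r := by
  unfold anisotropySum
  have : 0 ≤ r⁻¹ := by positivity
  linarith

/-- The explicit inverse of `A` on `[1, ∞)`: `r(y) = (y + √(y² − 4))/2`.
[cite: SutherlandEtAl2003CuprateThermalConductivityGap, Eq. 2] -/
def ratioOfSum (y : ℝ) : ℝ := (y + Real.sqrt (y ^ 2 - 4)) / 2

/-- Unfolding. [cite: SutherlandEtAl2003CuprateThermalConductivityGap, Eq. 2] -/
theorem ratioOfSum_def (y : ℝ) : ratioOfSum y = (y + Real.sqrt (y ^ 2 - 4)) / 2 := rfl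

/-- `r(2) = 1`. [cite: SutherlandEtAl2003CuprateThermalConductivityGap, Fig. 5 caption] -/
theorem ratioOfSum_two : ratioOfSum 2 = 1 := by norm_num [ratioOfSum]

/-- `r(y) ≥ y/2 ≥ 1` for `y ≥ 2`. [cite: SutherlandEtAl2003CuprateThermalConductivityGap, Eq. 2] -/
theorem one_le_ratioOfSum {y : ℝ} (hy : 2 ≤ y) : 1 ≤ ratioOfSum y := by
  unfold ratioOfSum
  have := Real.sqrt_nonneg (y ^ 2 - 4)
  linarith

/-- The conjugate root: `r(y) · (y − √(y² − 4))/2 = 1`.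
[cite: SutherlandEtAl2003CuprateThermalConductivityGap, Eq. 2] -/
theorem ratioOfSum_mul_conj {y : ℝ} (hy : 2 ≤ y) :
    ratioOfSum y * ((y - Real.sqrt (y ^ 2 - 4)) / 2) = 1 := by
  unfold ratioOfSum
  have h4 : 0 ≤ y ^ 2 - 4 := by nlinarith
  have hs := Real.mul_self_sqrt h4
  nlinarith [hs]

/-- `A(r(y)) = y` for `y ≥ 2`: every `κ₀/T ≥ 2P` is attained.
[cite: SutherlandEtAl2003CuprateThermalConductivityGap, Eq. 2] -/
theorem anisotropySum_ratioOfSum {y : ℝ} (hy : 2 ≤ y) : anisotropySum (ratioOfSum y) = y := by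
  have h1 := one_le_ratioOfSum hy
  have hne : ratioOfSum y ≠ 0 := by linarith
  have hconj := ratioOfSum_mul_conj hy
  have hinv : (ratioOfSum y)⁻¹ = (y - Real.sqrt (y ^ 2 - 4)) / 2 :=
    inv_eq_of_mul_eq_one_right hconj
  rw [anisotropySum, hinv, ratioOfSum]
  ring

/-- `r(A(r)) = r` for `r ≥ 1`. [cite: SutherlandEtAl2003CuprateThermalConductivityGap, Eq. 2] -/
theorem ratioOfSum_anisotropySum {r : ℝ} (hr : 1 ≤ r) : ratioOfSum (anisotropySum r) = r := by
  have hr0 : 0 < r := by linarith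
  have hsq : anisotropySum r ^ 2 - 4 = (r - r⁻¹) ^ 2 := by
    unfold anisotropySum
    field_simp
    ring
  have hnn : 0 ≤ r - r⁻¹ := by
    have : r⁻¹ ≤ 1 := inv_le_one_of_one_le₀ hr
    linarith
  rw [ratioOfSum, hsq, Real.sqrt_sq hnn, anisotropySum]
  ring

/-! ## §2 The dictionary `κ₀/T = P · A(v_F/v₂)` -/

/-- `κ(P, r) = P · (r + 1/r)`: the residual linear term `κ₀/T` for prefactor `P = (k_B²/3ħ)(n/d)` and
ratio `r = v_F/v₂`. [cite: SutherlandEtAl2003CuprateThermalConductivityGap, Eq. 2] -/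
def durstLeeKappa (P r : ℝ) : ℝ := P * anisotropySum r

/-- Unfolding. [cite: SutherlandEtAl2003CuprateThermalConductivityGap, Eq. 2] -/
theorem durstLeeKappa_def (P r : ℝ) : durstLeeKappa P r = P * (r + r⁻¹) := rfl

/-- Symmetry `v_F ↔ v₂`. [cite: SutherlandEtAl2003CuprateThermalConductivityGap, Eq. 2] -/
theorem durstLeeKappa_inv (P r : ℝ) : durstLeeKappa P r⁻¹ = durstLeeKappa P r := by
  rw [durstLeeKappa, durstLeeKappa, anisotropySum_inv]

/-- The universal floor `κ₀/T ≥ 2P`. [cite: SutherlandEtAl2003CuprateThermalConductivityGap, Fig. 5 caption] -/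
theorem two_mul_le_durstLeeKappa {P r : ℝ} (hP : 0 ≤ P) (hr : 0 < r) : 2 * P ≤ durstLeeKappa P r := by
  unfold durstLeeKappa
  have := two_le_anisotropySum hr
  nlinarith

/-- Monotonicity in the ratio on `r ≥ 1`. [cite: SutherlandEtAl2003CuprateThermalConductivityGap, Eq. 2] -/
theorem durstLeeKappa_lt {P a b : ℝ} (hP : 0 < P) (ha : 1 ≤ a) (hab : a < b) :
    durstLeeKappa P a < durstLeeKappa P b := by
  unfold durstLeeKappa
  exact mul_lt_mul_of_pos_left (anisotropySum_lt ha hab) hP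

/-- Inversion: for `κ ≥ 2P` the ratio `r(κ/P)` reproduces `κ`.
[cite: SutherlandEtAl2003CuprateThermalConductivityGap, Eq. 2] -/
theorem durstLeeKappa_ratioOfSum {P κ : ℝ} (hP : 0 < P) (hκ : 2 * P ≤ κ) :
    durstLeeKappa P (ratioOfSum (κ / P)) = κ := by
  have hy : 2 ≤ κ / P := by rwa [le_div_iff₀ hP]
  rw [durstLeeKappa, anisotropySum_ratioOfSum hy]
  field_simp

/-- … and it is the ONLY ratio `≥ 1` doing so. [cite: SutherlandEtAl2003CuprateThermalConductivityGap, Eq. 2] -/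
theorem ratio_eq_of_durstLeeKappa_eq {P r κ : ℝ} (hP : 0 < P) (hr : 1 ≤ r) (h : durstLeeKappa P r = κ) :
    r = ratioOfSum (κ / P) := by
  have hA : anisotropySum r = κ / P := by
    rw [eq_div_iff hP.ne', mul_comm]; exact h
  rw [← hA, ratioOfSum_anisotropySum hr]

/-- The large-ratio bracket `P r ≤ κ = P r (1 + 1/r²)`.
[cite: HawthornEtAl2007Tl2201GapHeatTransport, Eq. 5] -/
theorem durstLeeKappa_bracket {P r : ℝ} (hP : 0 ≤ P) (hr : 0 < r) :
    P * r ≤ durstLeeKappa P r ∧ durstLeeKappa P r = P * r * (1 + (r ^ 2)⁻¹) := by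
  refine ⟨?_, ?_⟩
  · unfold durstLeeKappa
    exact mul_le_mul_of_nonneg_left (le_anisotropySum hr) hP
  · rw [durstLeeKappa, anisotropySum_eq_mul hr.ne', mul_assoc]

/-! ## §3 The d-wave node: slope, gap velocity, and Hawthorn's Eq. 5 -/

/-- The `d_{x²−y²}` gap function `Δ(φ) = Δ₀ cos 2φ`.
[cite: SutherlandEtAl2003CuprateThermalConductivityGap, Fig. 6 caption] -/
def dWaveGap (Δ₀ φ : ℝ) : ℝ := Δ₀ * Real.cos (2 * φ)

/-- Unfolding. [cite: SutherlandEtAl2003CuprateThermalConductivityGap, Fig. 6 caption] -/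
theorem dWaveGap_def (Δ₀ φ : ℝ) : dWaveGap Δ₀ φ = Δ₀ * Real.cos (2 * φ) := rfl

/-- The gap maximum is at the antinode `φ = 0`. [cite: SutherlandEtAl2003CuprateThermalConductivityGap, Fig. 6 caption] -/
theorem dWaveGap_antinode (Δ₀ : ℝ) : dWaveGap Δ₀ 0 = Δ₀ := by simp [dWaveGap]

/-- The node: `Δ(π/4) = 0`. [cite: SutherlandEtAl2003CuprateThermalConductivityGap, Eq. 3] -/
theorem dWaveGap_node (Δ₀ : ℝ) : dWaveGap Δ₀ (π / 4) = 0 := by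
  rw [dWaveGap, show 2 * (π / 4) = π / 2 by ring, Real.cos_pi_div_two, mul_zero]

/-- `dΔ/dφ = −2Δ₀ sin 2φ`. [cite: SutherlandEtAl2003CuprateThermalConductivityGap, Eq. 3] -/
theorem hasDerivAt_dWaveGap (Δ₀ φ : ℝ) :
    HasDerivAt (dWaveGap Δ₀) (-(2 * Δ₀ * Real.sin (2 * φ))) φ := by
  have h1 : HasDerivAt (fun x : ℝ => 2 * x) 2 φ := by
    simpa using (hasDerivAt_id φ).const_mul (2 : ℝ)
  have h2 := (h1.cos).const_mul Δ₀
  refine h2.congr_deriv ?_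
  ring

/-- At the node the slope is `−2Δ₀`. [cite: SutherlandEtAl2003CuprateThermalConductivityGap, Eq. 3] -/
theorem hasDerivAt_dWaveGap_node (Δ₀ : ℝ) : HasDerivAt (dWaveGap Δ₀) (-(2 * Δ₀)) (π / 4) := by
  have h := hasDerivAt_dWaveGap Δ₀ (π / 4)
  rw [show 2 * (π / 4) = π / 2 by ring, Real.sin_pi_div_two, mul_one] at h
  exact h

/-- `deriv Δ (π/4) = −2Δ₀`. [cite: SutherlandEtAl2003CuprateThermalConductivityGap, Eq. 3] -/
theorem deriv_dWaveGap_node (Δ₀ : ℝ) : deriv (dWaveGap Δ₀) (π / 4) = -(2 * Δ₀) :=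
  (hasDerivAt_dWaveGap_node Δ₀).deriv

/-- `|dΔ/dφ|_node = 2Δ₀` for `Δ₀ ≥ 0`. [cite: SutherlandEtAl2003CuprateThermalConductivityGap, Eq. 3] -/
theorem abs_deriv_dWaveGap_node {Δ₀ : ℝ} (h : 0 ≤ Δ₀) : |deriv (dWaveGap Δ₀) (π / 4)| = 2 * Δ₀ := by
  rw [deriv_dWaveGap_node, abs_neg, abs_of_nonneg (by linarith)]

/-- The gap velocity `v₂ = (1/ħk_F) · |dΔ/dφ|_node`.
[cite: SutherlandEtAl2003CuprateThermalConductivityGap, Eq. 3] -/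
def gapVelocity (hbar kF slope : ℝ) : ℝ := slope / (hbar * kF)

/-- Unfolding. [cite: SutherlandEtAl2003CuprateThermalConductivityGap, Eq. 3] -/
theorem gapVelocity_def (hbar kF slope : ℝ) : gapVelocity hbar kF slope = slope / (hbar * kF) := rfl

/-- For the d-wave form, `v₂ = 2Δ₀/(ħk_F)`. [cite: SutherlandEtAl2003CuprateThermalConductivityGap, Eq. 3] -/
theorem gapVelocity_dWave {hbar kF Δ₀ : ℝ} (h : 0 ≤ Δ₀) :
    gapVelocity hbar kF |deriv (dWaveGap Δ₀) (π / 4)| = 2 * Δ₀ / (hbar * kF) := by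
  rw [abs_deriv_dWaveGap_node h, gapVelocity]

/-- `Δ₀ = ħ k_F v₂ / 2`. [cite: SutherlandEtAl2003CuprateThermalConductivityGap, Fig. 6 caption] -/
theorem gapMax_eq_half_hbar_kF_v2 {hbar kF Δ₀ : ℝ} (hh : hbar ≠ 0) (hk : kF ≠ 0) :
    hbar * kF * gapVelocity hbar kF (2 * Δ₀) / 2 = Δ₀ := by
  unfold gapVelocity
  field_simp

/-- Hawthorn's large-ratio constant IS the leading term of the universal formula: with
`v₂ = 2Δ₀/(ħk_F)`, `(C/ħ)(n/c)(v_F/v₂) = (C/2)(n/c) k_F v_F/Δ₀` — `ħ` cancels (`C = k_B²/3`).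
[cite: HawthornEtAl2007Tl2201GapHeatTransport, Eq. 5] -/
theorem hawthornEq5_leading {C hbar n c kF vF Δ₀ : ℝ} (hh : hbar ≠ 0) (hk : kF ≠ 0) (hΔ : Δ₀ ≠ 0) :
    C / hbar * (n / c) * (vF / gapVelocity hbar kF (2 * Δ₀)) = C / 2 * (n / c) * (kF * vF / Δ₀) := by
  unfold gapVelocity
  field_simp

/-- … and the exact formula exceeds it by the factor `1 + (v₂/v_F)²`.
[cite: HawthornEtAl2007Tl2201GapHeatTransport, Eq. 3 and Eq. 5] -/
theorem durstLee_eq_leading_mul {P vF v2 : ℝ} (hF : vF ≠ 0) (h2 : v2 ≠ 0) :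
    durstLeeKappa P (vF / v2) = P * (vF / v2) * (1 + (v2 / vF) ^ 2) := by
  rw [durstLeeKappa, anisotropySum_eq_mul (div_ne_zero hF h2)]
  field_simp

/-! ## §4 The SI constant `k_B²/3ħ` and the family prefactors -/

/-- `k_B²/(3ħ)` in `W K⁻²` from the exact 2019-SI `k_B` and `ħ = h/2π`.
[cite: SutherlandEtAl2003CuprateThermalConductivityGap, Eq. 2] -/
def durstLeeConstant : ℝ := boltzmannSI ^ 2 / (3 * hbarSI)

/-- `k_B²/(3ħ) = (2k_B²/3h) · π`. [cite: SutherlandEtAl2003CuprateThermalConductivityGap, Eq. 2] -/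
theorem durstLeeConstant_eq_pi : durstLeeConstant = 2 * boltzmannSI ^ 2 / (3 * planckSI) * π := by
  unfold durstLeeConstant hbarSI
  have hπ : (π : ℝ) ≠ 0 := Real.pi_ne_zero
  have hh : planckSI ≠ 0 := planckSI_pos.ne'
  field_simp

/-- `k_B²/3ħ ∈ (6.025166, 6.025169) × 10⁻¹³ W K⁻²`. [cite: SutherlandEtAl2003CuprateThermalConductivityGap, Eq. 2] -/
theorem durstLeeConstant_bounds :
    6.025166e-13 < durstLeeConstant ∧ durstLeeConstant < 6.025169e-13 := by
  rw [durstLeeConstant_eq_pi, boltzmannSI_def, planckSI_def]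
  constructor
  · have := Real.pi_gt_d6
    norm_num
    nlinarith
  · have := Real.pi_lt_d6
    norm_num
    nlinarith

/-- `k_B²/3ħ > 0`. [cite: SutherlandEtAl2003CuprateThermalConductivityGap, Eq. 2] -/
theorem durstLeeConstant_pos : 0 < durstLeeConstant := by
  have := durstLeeConstant_bounds.1; linarith

/-- The family prefactor `P = (k_B²/3ħ)(n/d)` in `μW K⁻² cm⁻¹` for `n` planes per cell of c-axis
length `d` ångström: `W K⁻² × Å⁻¹ = 10¹⁰ W K⁻² m⁻¹ = 10¹⁴ μW K⁻² cm⁻¹`.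
[cite: SutherlandEtAl2003CuprateThermalConductivityGap, Eq. 2] -/
def familyPrefactor (n : ℕ) (dAngstrom : ℝ) : ℝ := durstLeeConstant * 10 ^ 14 * n / dAngstrom

/-- Unfolding. [cite: SutherlandEtAl2003CuprateThermalConductivityGap, Eq. 2] -/
theorem familyPrefactor_def (n : ℕ) (d : ℝ) :
    familyPrefactor n d = durstLeeConstant * 10 ^ 14 * n / d := rfl

/-- YBa₂Cu₃O_y (`n = 2`, `d = 11.7 Å`): `P ∈ (10.2994, 10.2995) μW K⁻² cm⁻¹`.
[cite: SutherlandEtAl2003CuprateThermalConductivityGap, Eq. 2 and Table I] -/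
theorem familyPrefactor_ybco : 10.2994 < familyPrefactor 2 11.7 ∧ familyPrefactor 2 11.7 < 10.2995 := by
  have hb := durstLeeConstant_bounds
  unfold familyPrefactor
  constructor
  · rw [lt_div_iff₀ (by norm_num)]; push_cast; nlinarith [hb.1]
  · rw [div_lt_iff₀ (by norm_num)]; push_cast; nlinarith [hb.2]

/-- La₂₋ₓSrₓCuO₄ (`n = 2`, `d = 13.2 Å`): `P ∈ (9.1290, 9.1291)`; twice it, the printed minimum
«`(k_B²/3ħ)(n/d)(1 + 1) = 18.3 μW K⁻² cm⁻¹`», `∈ (18.258, 18.2582)`.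
[cite: SutherlandEtAl2003CuprateThermalConductivityGap, p. 7] -/
theorem familyPrefactor_lsco : 9.1290 < familyPrefactor 2 13.2 ∧ familyPrefactor 2 13.2 < 9.1291 ∧
    18.258 < 2 * familyPrefactor 2 13.2 ∧ 2 * familyPrefactor 2 13.2 < 18.2582 := by
  have hb := durstLeeConstant_bounds
  have h1 : 9.1290 < familyPrefactor 2 13.2 := by
    unfold familyPrefactor; rw [lt_div_iff₀ (by norm_num)]; push_cast; nlinarith [hb.1]
  have h2 : familyPrefactor 2 13.2 < 9.1291 := by
    unfold familyPrefactor; rw [div_lt_iff₀ (by norm_num)]; push_cast; nlinarith [hb.2]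
  exact ⟨h1, h2, by linarith, by linarith⟩

/-- Bi₂Sr₂CaCu₂O₈ (`n = 4` planes per `d = 30.9 Å`): `P ∈ (7.7995, 7.7996)`.
[cite: SutherlandEtAl2003CuprateThermalConductivityGap, Eq. 2 and Table I] -/
theorem familyPrefactor_bi2212 : 7.7995 < familyPrefactor 4 30.9 ∧ familyPrefactor 4 30.9 < 7.7996 := by
  have hb := durstLeeConstant_bounds
  unfold familyPrefactor
  constructor
  · rw [lt_div_iff₀ (by norm_num)]; push_cast; nlinarith [hb.1]
  · rw [div_lt_iff₀ (by norm_num)]; push_cast; nlinarith [hb.2]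

/-- Tl₂Ba₂CuO₆₊δ (`n = 2`, `c = 23.2 Å`, as printed): `P ∈ (5.1941, 5.19412)`.
[cite: HawthornEtAl2007Tl2201GapHeatTransport, Eq. 3] -/
theorem familyPrefactor_tl2201 : 5.1941 < familyPrefactor 2 23.2 ∧ familyPrefactor 2 23.2 < 5.19412 := by
  have hb := durstLeeConstant_bounds
  unfold familyPrefactor
  constructor
  · rw [lt_div_iff₀ (by norm_num)]; push_cast; nlinarith [hb.1]
  · rw [div_lt_iff₀ (by norm_num)]; push_cast; nlinarith [hb.2]

/-! ## §5 Consistency rows of [SutherlandEtAl2003…, Table I]: `P · A(r) ∈ [κ₀/T − err, κ₀/T + err]` -/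

/-- YBCO rows `(κ₀/T ± err, v_F/v₂) = (85 ± 10, 7.9)`, `(91 ± 13, 8.7)`, `(120 ± 12, 11.5)`,
`(160 ± 12, 15.5)` (`y = 6.54, 6.6, 6.95, 6.99`): each `P·A(r)` lies in the printed interval
(indeed within `0.4` of `82.7, 90.8, 119.3, 160.3`).
[cite: SutherlandEtAl2003CuprateThermalConductivityGap, Table I] -/
theorem sutherland2003_ybco_rows :
    durstLeeKappa (familyPrefactor 2 11.7) 7.9 ∈ Set.Icc (75 : ℝ) 95 ∧
    durstLeeKappa (familyPrefactor 2 11.7) 8.7 ∈ Set.Icc (78 : ℝ) 104 ∧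
    durstLeeKappa (familyPrefactor 2 11.7) 11.5 ∈ Set.Icc (108 : ℝ) 132 ∧
    durstLeeKappa (familyPrefactor 2 11.7) 15.5 ∈ Set.Icc (148 : ℝ) 172 := by
  have hb := familyPrefactor_ybco
  simp only [durstLeeKappa, anisotropySum, Set.mem_Icc]
  refine ⟨⟨?_, ?_⟩, ⟨?_, ?_⟩, ⟨?_, ?_⟩, ⟨?_, ?_⟩⟩ <;> norm_num <;> nlinarith [hb.1, hb.2]

/-- LSCO rows `(22 ± 2, 1.9)`, `(26 ± 10, 2.4)`, `(96 ± 7, 10.4)`, `(330 ± 40, 36)`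
(`x = 0.07, 0.09, 0.17, 0.20`). [cite: SutherlandEtAl2003CuprateThermalConductivityGap, Table I] -/
theorem sutherland2003_lsco_rows :
    durstLeeKappa (familyPrefactor 2 13.2) 1.9 ∈ Set.Icc (20 : ℝ) 24 ∧
    durstLeeKappa (familyPrefactor 2 13.2) 2.4 ∈ Set.Icc (16 : ℝ) 36 ∧
    durstLeeKappa (familyPrefactor 2 13.2) 10.4 ∈ Set.Icc (89 : ℝ) 103 ∧
    durstLeeKappa (familyPrefactor 2 13.2) 36 ∈ Set.Icc (290 : ℝ) 370 := by
  have hb := familyPrefactor_lsco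
  simp only [durstLeeKappa, anisotropySum, Set.mem_Icc]
  refine ⟨⟨?_, ?_⟩, ⟨?_, ?_⟩, ⟨?_, ?_⟩, ⟨?_, ?_⟩⟩ <;> norm_num <;> nlinarith [hb.1, hb.2.1]

/-- Bi-2212 `(150 ± 30, 19)` [ChiaoEtAl2000UniversalHeatTransportBi2212] and Tl-2201
`(1400 ± 70, 270)` [ProustEtAl2002Tl2201OverdopedHeatTransport], as compiled.
[cite: SutherlandEtAl2003CuprateThermalConductivityGap, Table I] -/
theorem sutherland2003_bi2212_tl2201_rows :
    durstLeeKappa (familyPrefactor 4 30.9) 19 ∈ Set.Icc (120 : ℝ) 180 ∧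
    durstLeeKappa (familyPrefactor 2 23.2) 270 ∈ Set.Icc (1330 : ℝ) 1470 := by
  have hb := familyPrefactor_bi2212
  have ht := familyPrefactor_tl2201
  simp only [durstLeeKappa, anisotropySum, Set.mem_Icc]
  refine ⟨⟨?_, ?_⟩, ⟨?_, ?_⟩⟩ <;> norm_num <;> nlinarith [hb.1, hb.2, ht.1, ht.2]

/-- The ARPES cross-check as printed: `v_F = 2.5 × 10⁷`, `v₂ = 1.25 × 10⁶ cm/s` give the ratio `20`
(vs `19` from `κ₀/T`). [cite: SutherlandEtAl2003CuprateThermalConductivityGap, p. 6] -/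
theorem mesot1999_ratio : (2.5e7 : ℝ) / 1.25e6 = 20 := by norm_num

/-- The printed «factor 2» between `y = 6.99` and `y = 6.54`: `160/85 ∈ (1.88, 1.89)` on `κ₀/T` and
`15.5/7.9 ∈ (1.96, 1.97)` on `v_F/v₂`. [cite: SutherlandEtAl2003CuprateThermalConductivityGap, p. 8] -/
theorem sutherland2003_factor_two :
    1.88 < (160 : ℝ) / 85 ∧ (160 : ℝ) / 85 < 1.89 ∧ 1.96 < (15.5 : ℝ) / 7.9 ∧ (15.5 : ℝ) / 7.9 < 1.97 := by
  norm_num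

/-! ## §6 The gap-maximum columns -/

/-- `ħ k_F v/2` in meV for `k_F` in `Å⁻¹` and a velocity `v` in `cm/s`
(`× 10¹⁰`, `× 10⁻²` to SI; `/e × 10³` to meV). [cite: SutherlandEtAl2003CuprateThermalConductivityGap, Fig. 6 caption] -/
def halfHbarKvMeV (kFperAngstrom v_cm_s : ℝ) : ℝ :=
  hbarSI * (kFperAngstrom * 10 ^ 10) * (v_cm_s / 100) / 2 / elementaryChargeSI * 1000

/-- Unfolding. [cite: SutherlandEtAl2003CuprateThermalConductivityGap, Fig. 6 caption] -/
theorem halfHbarKvMeV_def (k v : ℝ) :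
    halfHbarKvMeV k v = hbarSI * (k * 10 ^ 10) * (v / 100) / 2 / elementaryChargeSI * 1000 := rfl

/-- `ħk_F v/2 = h k_F v/(4π e)` with the exponents collected.
[cite: SutherlandEtAl2003CuprateThermalConductivityGap, Fig. 6 caption] -/
theorem halfHbarKvMeV_eq (k v : ℝ) :
    halfHbarKvMeV k v = planckSI * k * v * 10 ^ 11 / (4 * elementaryChargeSI) / π := by
  unfold halfHbarKvMeV hbarSI
  have hπ : (π : ℝ) ≠ 0 := Real.pi_ne_zero
  have he : elementaryChargeSI ≠ 0 := elementaryChargeSI_pos.ne'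
  field_simp
  ring

/-- The nodal energy scale at the printed `k_F = 0.7 Å⁻¹`, `v_F = 2.5 × 10⁷ cm/s`:
`ħk_F v_F/2 ∈ (575.93, 575.94) meV`. [cite: SutherlandEtAl2003CuprateThermalConductivityGap, p. 8] -/
theorem nodalScale_sut03 : 575.93 < halfHbarKvMeV 0.7 2.5e7 ∧ halfHbarKvMeV 0.7 2.5e7 < 575.94 := by
  rw [halfHbarKvMeV_eq, planckSI_def, elementaryChargeSI_def]
  have hπ : (0 : ℝ) < π := Real.pi_pos
  constructor
  · rw [lt_div_iff₀ hπ]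
    have := Real.pi_lt_d6
    norm_num
    nlinarith
  · rw [div_lt_iff₀ hπ]
    have := Real.pi_gt_d6
    norm_num
    nlinarith

/-- The printed `Δ₀ = ħk_F v_F/(2 r)` column of YBCO and Bi-2212: `r = 7.9 ↦ (72.9, 73.0)` (printed
`71`), `8.7 ↦ (66.1, 66.3)` (`66`), `11.5 ↦ (50.0, 50.1)` (`50`), `15.5 ↦ (37.1, 37.2)` (`37`),
`19 ↦ (30.3, 30.4)` (`30`) meV. [cite: SutherlandEtAl2003CuprateThermalConductivityGap, Table I] -/
theorem sutherland2003_gap_column :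
    (72.9 < halfHbarKvMeV 0.7 2.5e7 / 7.9 ∧ halfHbarKvMeV 0.7 2.5e7 / 7.9 < 73.0) ∧
    (66.1 < halfHbarKvMeV 0.7 2.5e7 / 8.7 ∧ halfHbarKvMeV 0.7 2.5e7 / 8.7 < 66.3) ∧
    (50.0 < halfHbarKvMeV 0.7 2.5e7 / 11.5 ∧ halfHbarKvMeV 0.7 2.5e7 / 11.5 < 50.1) ∧
    (37.1 < halfHbarKvMeV 0.7 2.5e7 / 15.5 ∧ halfHbarKvMeV 0.7 2.5e7 / 15.5 < 37.2) ∧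
    (30.3 < halfHbarKvMeV 0.7 2.5e7 / 19 ∧ halfHbarKvMeV 0.7 2.5e7 / 19 < 30.4) := by
  have hb := nodalScale_sut03
  refine ⟨⟨?_, ?_⟩, ⟨?_, ?_⟩, ⟨?_, ?_⟩, ⟨?_, ?_⟩, ⟨?_, ?_⟩⟩
  all_goals first
    | (rw [lt_div_iff₀ (by norm_num)]; linarith [hb.1, hb.2])
    | (rw [div_lt_iff₀ (by norm_num)]; linarith [hb.1, hb.2])

/-- The ARPES value [MesotEtAl1999Bi2212GapSlopeARPES] `v₂ = 1.25 × 10⁶ cm/s` gives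
`Δ₀ = ħk_F v₂/2 ∈ (28.79, 28.80) meV` (vs `30` from `κ₀/T`).
[cite: SutherlandEtAl2003CuprateThermalConductivityGap, p. 6] -/
theorem mesot1999_gap : 28.79 < halfHbarKvMeV 0.7 1.25e6 ∧ halfHbarKvMeV 0.7 1.25e6 < 28.80 := by
  rw [halfHbarKvMeV_eq, planckSI_def, elementaryChargeSI_def]
  have hπ : (0 : ℝ) < π := Real.pi_pos
  constructor
  · rw [lt_div_iff₀ hπ]
    have := Real.pi_lt_d6
    norm_num
    nlinarith
  · rw [div_lt_iff₀ hπ]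
    have := Real.pi_gt_d6
    norm_num
    nlinarith

/-- Hawthorn's Eq. 5 solved for the gap, in meV, for `κ₀/T` given in `mW K⁻² cm⁻¹` (`× 0.1` to
`W K⁻² m⁻¹`), with the printed `n = 2`, `c = 23.2 Å`, `k_F = 0.7 Å⁻¹`, `v_F = 2.7 × 10⁷ cm/s`:
`Δ₀ = (k_B²/6)(n/c) k_F v_F / (κ₀/T)`. [cite: HawthornEtAl2007Tl2201GapHeatTransport, Eq. 5] -/
def hawthornGapMeV (kappa_mW : ℝ) : ℝ :=
  boltzmannSI ^ 2 / 6 * (2 / (23.2e-10 : ℝ)) * (0.7 * 10 ^ 10) * (2.7e7 / 100) /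
    (kappa_mW / 10) / elementaryChargeSI * 1000

/-- Unfolding. [cite: HawthornEtAl2007Tl2201GapHeatTransport, Eq. 5] -/
theorem hawthornGapMeV_def (x : ℝ) : hawthornGapMeV x =
    boltzmannSI ^ 2 / 6 * (2 / (23.2e-10 : ℝ)) * (0.7 * 10 ^ 10) * (2.7e7 / 100) /
      (x / 10) / elementaryChargeSI * 1000 := rfl

/-- [HawthornEtAl2007Tl2201GapHeatTransport, Table I] reproduced from Eq. 5: `κ₀/T = 0.08 ↦ Δ₀ ∈
(40.3, 40.4)` (printed `40`), `0.15 ↦ (21.5, 21.6)` (`22`), `0.14 ↦ (23.0, 23.1)` (`23`),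
`0.12 ↦ (26.9, 27.0)` (`28` printed — the one row off by a meV at the printed precision of `κ₀/T`),
`0.34 ↦ (9.50, 9.51)` (`9.5`), `0.48 ↦ (6.73, 6.74)` (`6.7`), and the
[ProustEtAl2002Tl2201OverdopedHeatTransport] crystal `1.4 ↦ (2.30, 2.31)` (`2`) meV.
[cite: HawthornEtAl2007Tl2201GapHeatTransport, Table I] -/
theorem hawthorn2007_gap_column :
    (40.3 < hawthornGapMeV 0.08 ∧ hawthornGapMeV 0.08 < 40.4) ∧
    (21.5 < hawthornGapMeV 0.15 ∧ hawthornGapMeV 0.15 < 21.6) ∧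
    (23.0 < hawthornGapMeV 0.14 ∧ hawthornGapMeV 0.14 < 23.1) ∧
    (26.9 < hawthornGapMeV 0.12 ∧ hawthornGapMeV 0.12 < 27.0) ∧
    (9.50 < hawthornGapMeV 0.34 ∧ hawthornGapMeV 0.34 < 9.51) ∧
    (6.73 < hawthornGapMeV 0.48 ∧ hawthornGapMeV 0.48 < 6.74) ∧
    (2.30 < hawthornGapMeV 1.4 ∧ hawthornGapMeV 1.4 < 2.31) := by
  norm_num [hawthornGapMeV, boltzmannSI_def, elementaryChargeSI_def]

/-- The printed `Δ₀/k_BT_c` column: `(84 K, 0.08) ↦ (5.57, 5.59)` (`5.6`), `(76, 0.15) ↦ (3.28, 3.30)`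
(`3.4` printed from the rounded `22 meV`), `(72, 0.14) ↦ (3.71, 3.73)` (`3.8`), `(68, 0.12) ↦ (4.59, 4.60)`
(`4.8`), `(27, 0.34) ↦ (4.08, 4.09)` (`4.1`), `(26, 0.48) ↦ (3.00, 3.01)` (`3.0`) — all with the
file `kBmeVPerKelvin = k_B/e · 10³`. [cite: HawthornEtAl2007Tl2201GapHeatTransport, Table I] -/
theorem hawthorn2007_ratio_column :
    (5.57 * (kBmeVPerKelvin * 84) < hawthornGapMeV 0.08 ∧ hawthornGapMeV 0.08 < 5.59 * (kBmeVPerKelvin * 84)) ∧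
    (3.28 * (kBmeVPerKelvin * 76) < hawthornGapMeV 0.15 ∧ hawthornGapMeV 0.15 < 3.30 * (kBmeVPerKelvin * 76)) ∧
    (3.71 * (kBmeVPerKelvin * 72) < hawthornGapMeV 0.14 ∧ hawthornGapMeV 0.14 < 3.73 * (kBmeVPerKelvin * 72)) ∧
    (4.59 * (kBmeVPerKelvin * 68) < hawthornGapMeV 0.12 ∧ hawthornGapMeV 0.12 < 4.60 * (kBmeVPerKelvin * 68)) ∧
    (4.08 * (kBmeVPerKelvin * 27) < hawthornGapMeV 0.34 ∧ hawthornGapMeV 0.34 < 4.09 * (kBmeVPerKelvin * 27)) ∧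
    (3.00 * (kBmeVPerKelvin * 26) < hawthornGapMeV 0.48 ∧ hawthornGapMeV 0.48 < 3.01 * (kBmeVPerKelvin * 26)) := by
  norm_num [hawthornGapMeV, kBmeVPerKelvin, boltzmannSI_def, elementaryChargeSI_def]

/-- The weak-coupling d-wave reference `Δ₀ = 2.14 k_BT_c` as printed, against which `5.6 → 3.0` is
read: `5.6/2.14 ∈ (2.61, 2.62)`, `3.0/2.14 ∈ (1.40, 1.41)`.
[cite: HawthornEtAl2007Tl2201GapHeatTransport, p. 4] -/
theorem hawthorn2007_vs_weakCoupling :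
    2.61 < (5.6 : ℝ) / 2.14 ∧ (5.6 : ℝ) / 2.14 < 2.62 ∧ 1.40 < (3.0 : ℝ) / 2.14 ∧ (3.0 : ℝ) / 2.14 < 1.41 := by
  norm_num


/-! ## §7 (appended) YBa₂Cu₃O_y across the superconducting critical point `p_SC = 5 %` — a second
group's residual linear term [DoironLeyraudEtAl2006YBCOBosonModeKappa] read through Eq. 2 (REFVALS-2 §138.7) -/

/-- [Doiron-Leyraud et al. 2006]: time-doped YBa₂Cu₃O₆.₃₃ at `p ≃ 5.3–5.4 %` prints
«κ₀/T = 38 ± 3» (six samples) and «40 ± 1 μW K⁻² cm⁻¹» (sample L), constant across `p_SC`.  Through the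
universal formula with the YBCO prefactor `P = (k_B²/3ħ)(2/11.7 Å)` these bracket the velocity ratio:
`P·A(3.39) < 38 < P·A(3.40)`, `P·A(3.60) < 40 < P·A(3.61)`, and the bar `P·A(3.07) < 35`, `41 < P·A(3.72)`
(DERIVED; the paper prints `κ₀/T`, not `v_F/v₂`). [cite: DoironLeyraudEtAl2006YBCOBosonModeKappa, p. 3] -/
theorem doironLeyraud2006_rows :
    (durstLeeKappa (familyPrefactor 2 11.7) 3.39 < 38 ∧ 38 < durstLeeKappa (familyPrefactor 2 11.7) 3.40) ∧
    (durstLeeKappa (familyPrefactor 2 11.7) 3.60 < 40 ∧ 40 < durstLeeKappa (familyPrefactor 2 11.7) 3.61) ∧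
    (durstLeeKappa (familyPrefactor 2 11.7) 3.07 < 35 ∧ 41 < durstLeeKappa (familyPrefactor 2 11.7) 3.72) := by
  have hb := familyPrefactor_ybco
  simp only [durstLeeKappa, anisotropySum]
  refine ⟨⟨?_, ?_⟩, ⟨?_, ?_⟩, ⟨?_, ?_⟩⟩ <;> norm_num <;> nlinarith [hb.1, hb.2]

/-- Hence the UNIQUE ratio `v_F/v₂ ≥ 1` reproducing `κ₀/T = 38 μW K⁻² cm⁻¹` in YBCO lies in `(3.39, 3.40)`
— versus `7.9` at `y = 6.54` and `14–15.5` at `y = 6.95–6.99` (§5): the printed fall of `v_F/v₂` with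
underdoping continues to `p ≈ 5 %`. [cite: DoironLeyraudEtAl2006YBCOBosonModeKappa, p. 3] -/
theorem doironLeyraud2006_ratio38 {r : ℝ} (hr : 1 ≤ r) (h : durstLeeKappa (familyPrefactor 2 11.7) r = 38) :
    3.39 < r ∧ r < 3.40 := by
  have hP : 0 < familyPrefactor 2 11.7 := lt_trans (by norm_num) familyPrefactor_ybco.1
  obtain ⟨⟨h1, h2⟩, -, -⟩ := doironLeyraud2006_rows
  constructor
  · rcases le_or_gt r 3.39 with hle | hlt
    · exfalso
      rcases lt_or_eq_of_le hle with hlt | heq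
      · have := durstLeeKappa_lt hP hr hlt; linarith
      · rw [heq] at h; linarith
    · exact hlt
  · rcases le_or_gt 3.40 r with hle | hlt
    · exfalso
      rcases lt_or_eq_of_le hle with hlt | heq
      · have := durstLeeKappa_lt hP (by norm_num) hlt; linarith
      · rw [← heq] at h; linarith
    · exact hlt

/-- … and the one reproducing `40 μW K⁻² cm⁻¹` (sample L) lies in `(3.60, 3.61)`.
[cite: DoironLeyraudEtAl2006YBCOBosonModeKappa, p. 3] -/
theorem doironLeyraud2006_ratio40 {r : ℝ} (hr : 1 ≤ r) (h : durstLeeKappa (familyPrefactor 2 11.7) r = 40) :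
    3.60 < r ∧ r < 3.61 := by
  have hP : 0 < familyPrefactor 2 11.7 := lt_trans (by norm_num) familyPrefactor_ybco.1
  obtain ⟨-, ⟨h1, h2⟩, -⟩ := doironLeyraud2006_rows
  constructor
  · rcases le_or_gt r 3.60 with hle | hlt
    · exfalso
      rcases lt_or_eq_of_le hle with hlt | heq
      · have := durstLeeKappa_lt hP hr hlt; linarith
      · rw [heq] at h; linarith
    · exact hlt
  · rcases le_or_gt 3.61 r with hle | hlt
    · exfalso
      rcases lt_or_eq_of_le hle with hlt | heq
      · have := durstLeeKappa_lt hP (by norm_num) hlt; linarith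
      · rw [← heq] at h; linarith
    · exact hlt

/-- The implied nodal gap slope at the §6 scale `ħk_F v_F/2 ∈ (575.93, 575.94) meV` (`k_F = 0.7 Å⁻¹`,
`v_F = 2.5 × 10⁷ cm/s` as in [SutherlandEtAl2003CuprateThermalConductivityGap]): `r = 3.4 ↦ Δ₀ ∈ (169.3, 169.4)`,
`r = 3.6 ↦ (159.9, 160.0) meV` — a pseudogap-size slope at `p ≈ 5 %`, versus `(72.9, 73.0)` at `y = 6.54`
(`sutherland2003_gap_column`). DERIVED image only. [cite: DoironLeyraudEtAl2006YBCOBosonModeKappa, p. 4] -/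
theorem doironLeyraud2006_gap_images :
    (169.3 < halfHbarKvMeV 0.7 2.5e7 / 3.4 ∧ halfHbarKvMeV 0.7 2.5e7 / 3.4 < 169.4) ∧
    (159.9 < halfHbarKvMeV 0.7 2.5e7 / 3.6 ∧ halfHbarKvMeV 0.7 2.5e7 / 3.6 < 160.0) := by
  have hb := nodalScale_sut03
  refine ⟨⟨?_, ?_⟩, ⟨?_, ?_⟩⟩
  all_goals first
    | (rw [lt_div_iff₀ (by norm_num)]; linarith [hb.1, hb.2])
    | (rw [div_lt_iff₀ (by norm_num)]; linarith [hb.1, hb.2])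

/-- The boson `βT³` term below `p_SC`: the two printed differences `β = 476` (4.7 % − 5.4 %) and `283`
(5.0 % − 5.4 %) μW K⁻⁴ cm⁻¹ are ordered as the dopings (`β` «decreases roughly linearly until 5.2 %»), and at
the fit ceiling `T = 0.6 K` the larger one contributes `βT² ∈ (171.3, 171.4) μW K⁻² cm⁻¹` to `κ/T` — more than
four times the fermionic `κ₀/T = 38`. [cite: DoironLeyraudEtAl2006YBCOBosonModeKappa, p. 3] -/
theorem doironLeyraud2006_boson_rows :
    (283 : ℝ) < 476 ∧ (171.3 < (476 : ℝ) * 0.6 ^ 2 ∧ (476 : ℝ) * 0.6 ^ 2 < 171.4) ∧ 4 * (38 : ℝ) < 476 * 0.6 ^ 2 := by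
  norm_num

end Literature.MathematicalPhysics.QuantumLattice.NodalHeatTransport

end
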